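/-
Copyright: lit-balaban Phase-2 proof seat p30 (gen 25).  Statement-level skeleton of a published paper; no proof claims beyond what the
kernel checks below.
-/
import Literature.MathematicalPhysics.QuantumFieldTheory.Balaban1983to89.B3Sect3KernelsZeroTorus

/-!
# [BalabanImbrieJaffe1985] §7.3 p. 326 / [Balaban1983RegularityDecay] (1.10) — kernel inputs for the COVARIANT-DERIVATIVE member of the
# sup-norm decay of `G_k(u)` at non-flat small fields: **first and mixed second lattice differences of the flat torus block propagator
# `G_k(T_ε,0)`**: `|G(x+e_μ,x′) − G(x,x′)| ≤ Cε²·max(|x−x′|_∞,1)^{−(d−1)}` and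
# `|G(x+e_μ,x′+e_ν) − G(x+e_μ,x′) − G(x,x′+e_ν) + G(x,x′)| ≤ Cε²·max(|x−x′|_∞,1)^{−d}`, `d ≥ 2`, uniform in the volume and in `1 ≤ k ≤ K`

T. Bałaban, J. Imbrie, A. Jaffe, *Renormalization of the Higgs model: minimizers, propagators and the stability of mean field theory*,
Commun. Math. Phys. **97** (1985) 299–329 [BalabanImbrieJaffe1985], §7.3 p. 326 [PDF 28]; T. Bałaban, *(Higgs)₂,₃ quantum fields in a
finite volume. III. Renormalization*, Commun. Math. Phys. **88** (1983) 411–445 [Balaban1983Higgs3], (2.6) p. 424, (2.10) p. 426, p. 437;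
[7] of [BalabanImbrieJaffe1985] = [Balaban1983RegularityDecay], Commun. Math. Phys. **89** (1983) 571–597, (1.10) p. 573.

statement-level skeleton of published theorems with citation tags; proofs where landed; nothing here is a claim about the Yang–Mills mass gap

CITATION HEADER (lean-in-tree rule).  Part of the lit-balaban TYPED SKELETON (HOME `run/shared/lean/pub/lit-balaban/`), PHASE-2 proof seat
p30 gen 25 (unit `lit-balaban-p30-g25`; TAKING line HOME/STATUS.md 2026-08-22T22:31:47Z; free-target protocol G.5-34(d) — the residual of
item 3 of the owner's `HOME/lit-balaban-r15/C1-CLOSURE.md` §5 (owner r15, referee ref-5): *"Still free here (M/L): the D_u-derivative …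
members at small non-flat u"*, = p27 g32's declared natural extension *"the D_u-DERIVATIVE member of (1.10) at non-flat fields (Kato gives
only values; needs a covariant gradient bound …)"*).  WHAT THIS FILE IS: kernel file 1 of 3 of the derivative member — the KERNEL INPUTS
(row **C1.Eq7.3.1-7.3.2** of `HOME/lit-balaban-r15/ROWS-C1.md`, a located input of a located member; no head effect); the zero-field
torus objects are those of rows B3.Eq2.10 / B3.Eq3.11-3.17 (owner r15).  Kind «model-level theorems only» (no new definition, no
`Prop`-valued fact introduced).

THE PRINTED TEXT (verbatim).  [BalabanImbrieJaffe1985] p. 326 [PDF 28]: *"The propagators arising from Δ_k(u_k), under the restriction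
(7.3.1) on the gauge field, also satisfy the regularity and decay estimates of [7]."*  [7] (1.10) p. 573 (as transcribed in the tree's
`Balaban1983to89.B4Thm110ZeroTorus`): *"|(D^η_{A,μ}G_k(Ω, A)f)(x)|, |(G_k(Ω, A)f)(x)| ≤ c₀exp(−δ₀ dist(x, supp f))‖f‖_∞ (1.10)"*.
[Balaban1983Higgs3] p. 437 [PDF 27]: *"|G^ξ_{j″}(0; y, y′)| ≦ O(1)e^{−δ₀|y−y′|}/|y − y′|, and the corresponding inequalities for derivatives"*.

THE OBJECT.  `G = (B1RG242Torus.tower P a msq).G k`, Bałaban's zero-field scalar torus block propagator `G_k(T_ε,0) =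
(−Δ^ε + m² + a_k(L^kε)^{−2}Q_k^*Q_k)^{−1}` (pv07's tower of [Balaban1982Higgs1] (2.42)/(2.43)), a real matrix on the fine torus
`T^{(0)} = Site P 0` in the counting-measure normalisation; at `m² = 0` it is, entrywise, p31's flat covariant block propagator
`gBox (α_kL^{kd}) ε⁻¹ 1 k T` of [BalabanImbrieJaffe1985] (4.6.2) (`BIJ88NeumannPropagatorFlatDecay.gBox_flat_eq_tower`).  Its scale
pieces `G^η_{(j)} = gpiece P a msq k j` (p20's `B3Sect3KernelsZeroTorus`; `Σ_{j<k} gpiece j = ε^{−d}G`, p03's `sum_pieceT`) obey the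
(2.10)-type bounds `gpiece_bounds`: `|∂^ε_μG^η_{(j)}(x,x′)| ≤ C(L^jε)^{1−d}e^{−δ|x−x′|₁/L^j}` (r15's `d1Kernel`),
`|(∂^ε_μG^η_{(j)}∂^{ε*}_ν)(x,x′)| ≤ C(L^jε)^{−d}e^{−δ|x−x′|₁/L^j}` (r15's `d2Kernel`), uniformly in the volume and in `1 ≤ k ≤ K`.

THE MECHANISM.  Summing the piece bounds over the scales `j < k` with p39's `B3GkZeroBoxPointwise.scaleSum_le`
(`Σ_{j<k}(L^j)^{−p}e^{−δn/L^j} ≤ C_s·n^{−p}` for `n ≥ 1`, `p ≥ 1`) and the geometric series at `n = 0` (`scaleSum_le_max`): the sum over the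
scales produces the near-diagonal laws `|x−x′|^{1−d}`, `|x−x′|^{−d}` (`|x−x′|₁ ≥ |x−x′|_∞`), exactly as in p39's `B3GkZeroTorusPointwise`
(value and first difference); here the first difference INCLUDING the diagonal `x = x′` and the MIXED second difference, which are the
two kernel inputs of the interior gradient estimate of the companion file `BIJ85ScalarPropagatorSupDecayDeriv`.

WHAT IS PROVED (0 `sorry`; standard axioms).
* §1 **`scaleSum_le_max`**: `∃ C > 0`, `Σ_{j<k}((L^j)⁻¹)^p e^{−δn/L^j} ≤ C·max(n,1)^{−p}` for every `k` and every `n ∈ ℕ` (`L > 1`, `δ > 0`,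
  `p ≥ 1`; `C = C_s + L/(L−1)`, `C_s` the constant of p39's `scaleSum_le`).
* §2 `diff₁_eq_sum_pieces`, `diff₂_eq_sum_pieces`: the propagator differences as `ε^{d+1}Σ_{j<k}d1Kernel`, `ε^{d+2}Σ_{j<k}d2Kernel` of the pieces.
* §3 **`flat_kernel_diffs`**: for `d ≥ 2`, odd `L > 1`, `a > 0`, `m² ≥ 0` there is `C > 0` (a function of `d, L, a, m²`) with, for EVERY volume
  `P` (`P.d = d`, `P.L = L`), every `1 ≤ k ≤ K`, all `μ, ν, x, x′`:
  `|G(x+e_μ,x′) − G(x,x′)| ≤ Cε²/max(|x−x′|_∞,1)^{d−1}` and `|G(x+e_μ,x′+e_ν) − G(x+e_μ,x′) − G(x,x′+e_ν) + G(x,x′)| ≤ Cε²/max(|x−x′|_∞,1)^d`.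

HONEST SCOPE.  `A = 0`, `U ≡ 1`, whole torus, `d ≥ 2` (at `d = 1` the piece bounds `(L^jε)^0` do not sum uniformly in `k`); forward
differences; the exponential factor `e^{−(δ/2)|x−x′|/L^{k−1}}` of `scaleSum_le` is discarded (not needed downstream); existential constant.
Nothing here is summit progress.  Unit `lit-balaban-p30` (literature-prover-lit-balaban-p30-g25-0), HOME `run/shared/lean/pub/lit-balaban/`,
2026-08-22.
-/

open scoped BigOperators
open Finset Matrix

namespace Literature.MathematicalPhysics.QuantumFieldTheory.BalabanImbrieJaffe1984to88.BIJ85FlatPropagatorKernelDiffs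

open Literature.MathematicalPhysics.QuantumFieldTheory.Balaban1983to89
open B1RG242Torus (tower)
open LatticeFieldCalculus (supDist)
open B3Sect3ScalarSelfEnergy (d1Kernel)
open B3Sect3VectorSelfEnergy (d2Kernel)
open B3Ineq210ZeroTorus (pieceT sum_pieceT)
open B3Sect3KernelsZeroTorus (gpiece gpiece_bounds)
open B3GkZeroBoxPointwise (scaleSum_le)
open B3TorusRadialSums (supDist_le_tdist supDist_eq_zero_iff)

noncomputable section

variable {P : Params}

/-! ## §1 Real-analysis bookkeeping: the scale factors and the sum over the scales -/

/-- kernel: `x^{(1−d)} = (x⁻¹)^{d−1}` as a real power, `x > 0`, `d ≥ 1`. [folklore] -/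
private theorem rpow_one_sub_natCast {x : ℝ} (hx : 0 < x) {d : ℕ} (hd : 1 ≤ d) :
    x ^ ((1 : ℝ) - (d : ℝ)) = x⁻¹ ^ (d - 1) := by
  rw [Real.rpow_sub hx, Real.rpow_one, Real.rpow_natCast, inv_pow]
  obtain ⟨n, rfl⟩ : ∃ n, d = n + 1 := ⟨d - 1, by omega⟩
  rw [Nat.add_sub_cancel, pow_succ]
  field_simp

/-- kernel: `x^{(−d)} = (x⁻¹)^d` as a real power, `x > 0`. [folklore] -/
private theorem rpow_neg_natCast' {x : ℝ} (hx : 0 < x) (d : ℕ) : x ^ (-(d : ℝ)) = x⁻¹ ^ d := by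
  rw [Real.rpow_neg hx.le, Real.rpow_natCast, inv_pow]

/-- kernel: `(L^jε)⁻¹^p = (ε⁻¹)^p·((L^j)⁻¹)^p`. [folklore] -/
private theorem spacing_inv_pow (P : Params) (j p : ℕ) :
    (P.spacing j)⁻¹ ^ p = (P.eps⁻¹) ^ p * (((P.L : ℝ) ^ j)⁻¹) ^ p := by
  unfold Params.spacing
  rw [mul_inv, mul_pow, mul_comm]

/-- kernel: the exponent of the piece bounds, `δ(L^jε)⁻¹(εn) = δn/L^j`. [folklore] -/
private theorem rate_rewrite (P : Params) (δ : ℝ) (j : ℕ) (n : ℝ) :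
    δ * (P.spacing j)⁻¹ * (P.eps * n) = δ * n / (P.L : ℝ) ^ j := by
  unfold Params.spacing
  have hε : P.eps ≠ 0 := P.eps_pos.ne'
  have hL : (P.L : ℝ) ^ j ≠ 0 := pow_ne_zero _ P.cast_L_pos.ne'
  field_simp

/-- kernel: the geometric bound for the diagonal entries, `Σ_{j<k}((L^j)⁻¹)^p ≤ L/(L−1)` (`L > 1`, `p ≥ 1`). [folklore] -/
private theorem sum_inv_pow_le {L : ℝ} (hL : 1 < L) {p : ℕ} (hp : 1 ≤ p) (k : ℕ) :
    ∑ j ∈ range k, ((L ^ j)⁻¹) ^ p ≤ L / (L - 1) := by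
  have hL0 : 0 < L := by linarith
  have hq0 : 0 ≤ L⁻¹ := inv_nonneg.2 hL0.le
  have hq1 : L⁻¹ < 1 := inv_lt_one_of_one_lt₀ hL
  have hterm : ∀ j ∈ range k, ((L ^ j)⁻¹) ^ p ≤ (L⁻¹) ^ j := by
    intro j _
    have h1 : (L ^ j)⁻¹ ≤ 1 := inv_le_one_of_one_le₀ (one_le_pow₀ hL.le)
    have h0 : 0 ≤ (L ^ j)⁻¹ := inv_nonneg.2 (pow_nonneg hL0.le _)
    calc ((L ^ j)⁻¹) ^ p ≤ ((L ^ j)⁻¹) ^ 1 := pow_le_pow_of_le_one h0 h1 hp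
      _ = (L⁻¹) ^ j := by rw [pow_one, inv_pow]
  calc ∑ j ∈ range k, ((L ^ j)⁻¹) ^ p ≤ ∑ j ∈ range k, (L⁻¹) ^ j := sum_le_sum hterm
    _ ≤ ∑' j, (L⁻¹) ^ j := (summable_geometric_of_lt_one hq0 hq1).sum_le_tsum (range k) (fun j _ => pow_nonneg hq0 j)
    _ = (1 - L⁻¹)⁻¹ := tsum_geometric_of_lt_one hq0 hq1
    _ = L / (L - 1) := by
        have : L - 1 ≠ 0 := by linarith
        field_simp

/-- **THE SCALE SUM WITH THE DIAGONAL INCLUDED**: for `L > 1`, `δ > 0`, `p ≥ 1` there is `C > 0` (namely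
`C_s(L,δ,p) + L/(L−1)`, `C_s` the constant of p39's `scaleSum_le`) such that for every `k` and every lattice distance `n ∈ ℕ`,
`Σ_{j<k}((L^j)⁻¹)^p e^{−δn/L^j} ≤ C·max(n,1)^{−p}` (`scaleSum_le` for `n ≥ 1`, the geometric series at `n = 0`).
[cite: Balaban1983Higgs3, (2.10) p.426] -/
theorem scaleSum_le_max {L δ : ℝ} (hL : 1 < L) (hδ : 0 < δ) {p : ℕ} (hp : 1 ≤ p) :
    ∃ C : ℝ, 0 < C ∧ ∀ k n : ℕ, ∑ j ∈ range k, ((L ^ j)⁻¹) ^ p * Real.exp (-(δ * n / L ^ j)) ≤ C / (max (n : ℝ) 1) ^ p := by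
  have hL0 : 0 < L := by linarith
  have hgeo : 0 < L / (L - 1) := div_pos hL0 (by linarith)
  set Cs : ℝ := L / (L - 1) * Real.exp (δ / 2) + (p.factorial : ℝ) / (δ / 2) ^ p * (1 - Real.exp (-(δ / 2 * (L - 1))))⁻¹ with hCs
  have hCs0 : 0 ≤ Cs := by
    have h2 : 0 < 1 - Real.exp (-(δ / 2 * (L - 1))) := by
      rw [sub_pos, Real.exp_lt_one_iff]
      have : 0 < δ / 2 * (L - 1) := mul_pos (by positivity) (by linarith)
      linarith
    positivity
  refine ⟨Cs + L / (L - 1), add_pos_of_nonneg_of_pos hCs0 hgeo, fun k n => ?_⟩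
  rcases Nat.eq_zero_or_pos n with hn | hn
  · -- diagonal: `n = 0`
    subst hn
    have hmax : max ((0 : ℕ) : ℝ) 1 = 1 := by simp
    rw [hmax, one_pow, div_one]
    calc ∑ j ∈ range k, ((L ^ j)⁻¹) ^ p * Real.exp (-(δ * ((0 : ℕ) : ℝ) / L ^ j))
        = ∑ j ∈ range k, ((L ^ j)⁻¹) ^ p := sum_congr rfl fun j _ => by simp
      _ ≤ L / (L - 1) := sum_inv_pow_le hL hp k
      _ ≤ Cs + L / (L - 1) := le_add_of_nonneg_left hCs0
  · have hn' : (0 : ℝ) < n := by exact_mod_cast hn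
    have hmax : max (n : ℝ) 1 = n := max_eq_left (by exact_mod_cast hn)
    rw [hmax]
    have h := scaleSum_le hL hδ hp k hn'
    have hexp : Real.exp (-(δ / 2 * ((n : ℝ) / L ^ (k - 1)))) ≤ 1 := by
      rw [Real.exp_le_one_iff, neg_nonpos]; positivity
    calc ∑ j ∈ range k, ((L ^ j)⁻¹) ^ p * Real.exp (-(δ * n / L ^ j))
        ≤ Cs * (n : ℝ)⁻¹ ^ p * Real.exp (-(δ / 2 * ((n : ℝ) / L ^ (k - 1)))) := h
      _ ≤ Cs * (n : ℝ)⁻¹ ^ p * 1 := mul_le_mul_of_nonneg_left hexp (by positivity)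
      _ = Cs / (n : ℝ) ^ p := by rw [mul_one, inv_pow, div_eq_mul_inv]
      _ ≤ (Cs + L / (L - 1)) / (n : ℝ) ^ p :=
          div_le_div_of_nonneg_right (le_add_of_nonneg_right hgeo.le) (by positivity)

/-! ## §2 The propagator differences as sums of piece differences -/

/-- `G_k(T_ε,0)(x+e_μ,x′) − G_k(T_ε,0)(x,x′) = ε^{d+1}·Σ_{j<k}(∂^ε_μG^η_{(j)})(x,x′)` — the first-variable difference of the zero-field torus
propagator through the `η^{−d}`-normalised scale pieces (2.6) (r15's `d1Kernel`, p20's `gpiece`, p03's `sum_pieceT`).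
[cite: Balaban1983Higgs3, (2.6) p.424] -/
theorem diff₁_eq_sum_pieces {a msq : ℝ} (ha : 0 < a) (hm : 0 ≤ msq) {k : ℕ} (hk : 1 ≤ k) (μ : Fin P.d) (x x' : Site P 0) :
    (tower P a msq).G k (x.shift μ) x' - (tower P a msq).G k x x' =
      P.eps ^ (P.d + 1) * ∑ j ∈ range k, d1Kernel P.eps⁻¹ μ (gpiece P a msq k j) x x' := by
  have hε : P.eps ≠ 0 := P.eps_pos.ne'
  have hεd : P.eps ^ P.d ≠ 0 := pow_ne_zero _ hε
  have hsum : ∀ y : Site P 0, ∑ j ∈ range k, pieceT P a msq k j y x' = (tower P a msq).G k y x' := fun y => by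
    rw [← sum_pieceT ha hm hk, Matrix.sum_apply]
  have h1 : ∀ j, d1Kernel P.eps⁻¹ μ (gpiece P a msq k j) x x' =
      P.eps⁻¹ * (P.eps ^ P.d)⁻¹ * (pieceT P a msq k j (x.shift μ) x' - pieceT P a msq k j x x') := fun j => by
    simp only [d1Kernel, gpiece]; ring
  rw [Finset.sum_congr rfl (fun j _ => h1 j), ← Finset.mul_sum, Finset.sum_sub_distrib, hsum, hsum, pow_succ]
  field_simp

/-- `G(x+e_μ,x′+e_ν) − G(x+e_μ,x′) − G(x,x′+e_ν) + G(x,x′) = ε^{d+2}·Σ_{j<k}(∂^ε_μG^η_{(j)}∂^{ε*}_ν)(x,x′)` (r15's `d2Kernel`).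
[cite: Balaban1983Higgs3, (2.6) p.424] -/
theorem diff₂_eq_sum_pieces {a msq : ℝ} (ha : 0 < a) (hm : 0 ≤ msq) {k : ℕ} (hk : 1 ≤ k) (μ ν : Fin P.d) (x x' : Site P 0) :
    (tower P a msq).G k (x.shift μ) (x'.shift ν) - (tower P a msq).G k (x.shift μ) x'
        - (tower P a msq).G k x (x'.shift ν) + (tower P a msq).G k x x' =
      P.eps ^ (P.d + 2) * ∑ j ∈ range k, d2Kernel P.eps⁻¹ μ ν (gpiece P a msq k j) x x' := by
  have hε : P.eps ≠ 0 := P.eps_pos.ne'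
  have hεd : P.eps ^ P.d ≠ 0 := pow_ne_zero _ hε
  have hsum : ∀ y y' : Site P 0, ∑ j ∈ range k, pieceT P a msq k j y y' = (tower P a msq).G k y y' := fun y y' => by
    rw [← sum_pieceT ha hm hk, Matrix.sum_apply]
  have h1 : ∀ j, d2Kernel P.eps⁻¹ μ ν (gpiece P a msq k j) x x' =
      P.eps⁻¹ ^ 2 * (P.eps ^ P.d)⁻¹ * (pieceT P a msq k j (x.shift μ) (x'.shift ν) - pieceT P a msq k j (x.shift μ) x'
        - pieceT P a msq k j x (x'.shift ν) + pieceT P a msq k j x x') := fun j => by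
    simp only [d2Kernel, gpiece]; ring
  rw [Finset.sum_congr rfl (fun j _ => h1 j), ← Finset.mul_sum, Finset.sum_add_distrib, Finset.sum_sub_distrib,
    Finset.sum_sub_distrib, hsum, hsum, hsum, hsum, pow_add]
  field_simp

/-! ## §3 The bounds, uniform in the volume and the scale -/

/-- **FIRST AND MIXED SECOND DIFFERENCES OF THE FLAT TORUS BLOCK PROPAGATOR** `G_k(T_ε,0) = (−Δ^ε + m² + a_k(L^kε)^{−2}Q_k^*Q_k)^{−1}`
(Bałaban's scalar torus tower `B1RG242Torus.tower`, matrix entries in the counting-measure normalisation): for `d ≥ 2`, odd `L > 1`,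
`a > 0`, `m² ≥ 0` there is `C > 0` (a function of `d, L, a, m²`) such that for EVERY volume `P` (`P.d = d`, `P.L = L`), every `1 ≤ k ≤ K`,
all directions and all sites: `|G(x+e_μ,x′) − G(x,x′)| ≤ Cε²·max(|x−x′|_∞,1)^{−(d−1)}` and
`|G(x+e_μ,x′+e_ν) − G(x+e_μ,x′) − G(x,x′+e_ν) + G(x,x′)| ≤ Cε²·max(|x−x′|_∞,1)^{−d}` — the *"corresponding inequalities for derivatives"* of
[Balaban1983Higgs3] p. 437 for one difference in the first variable and one difference in each variable, by summing p20's piece bounds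
`gpiece_bounds` ((2.10) at the zero-field torus instance) over the scales with p39's `scaleSum_le`; the near-diagonal law `|x−x′|^{1−d}`,
`|x−x′|^{−d}` is what the sum over the scales produces.  These are the kernel inputs of the interior gradient estimate of the companion file
`BIJ85ScalarPropagatorSupDecayDeriv` ([BalabanImbrieJaffe1985] p. 326, the derivative member of [7] (1.10)).
[cite: Balaban1983Higgs3, (2.10) p.426, p.437; BalabanImbrieJaffe1985, (7.3.2) p.326] -/
theorem flat_kernel_diffs (d L : ℕ) (hd : 2 ≤ d) (hL : Odd L ∧ 1 < L) {a : ℝ} (ha : 0 < a) {msq : ℝ} (hmsq : 0 ≤ msq) :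
    ∃ C : ℝ, 0 < C ∧ ∀ (P : Params), P.d = d → P.L = L → ∀ k : ℕ, 1 ≤ k → k ≤ P.K →
      (∀ (μ : Fin P.d) (x x' : Site P 0),
        |(tower P a msq).G k (x.shift μ) x' - (tower P a msq).G k x x'| ≤
          C * P.eps ^ 2 / (max (supDist x x' : ℝ) 1) ^ (d - 1)) ∧
      (∀ (μ ν : Fin P.d) (x x' : Site P 0),
        |(tower P a msq).G k (x.shift μ) (x'.shift ν) - (tower P a msq).G k (x.shift μ) x'
            - (tower P a msq).G k x (x'.shift ν) + (tower P a msq).G k x x'| ≤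
          C * P.eps ^ 2 / (max (supDist x x' : ℝ) 1) ^ d) := by
  obtain ⟨δ, C, hδ, hC, hmain⟩ := gpiece_bounds d L (by omega) hL ha hmsq
  have hL1 : (1 : ℝ) < L := by exact_mod_cast hL.2
  have hL0 : (0 : ℝ) < L := by linarith
  obtain ⟨S₁, hS₁pos, hS₁⟩ := scaleSum_le_max hL1 hδ (p := d - 1) (by omega)
  obtain ⟨S₂, hS₂pos, hS₂⟩ := scaleSum_le_max hL1 hδ (p := d) (by omega)
  refine ⟨C * max S₁ S₂, mul_pos hC (lt_max_of_lt_left hS₁pos), ?_⟩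
  intro P hPd hPL k hk1 hkK
  obtain ⟨_, hd1, _, hd2⟩ := hmain P hPd hPL k hk1 hkK
  subst hPd; subst hPL
  have hkm : 1 ≤ k := hk1
  have hε : 0 < P.eps := P.eps_pos
  have hpow₁ : P.eps ^ (P.d + 1) * (P.eps⁻¹) ^ (P.d - 1) = P.eps ^ 2 := by
    have := P.hd
    rw [inv_pow, ← div_eq_mul_inv, div_eq_iff (pow_ne_zero _ hε.ne'), ← pow_add]
    congr 1; omega
  have hpow₂ : P.eps ^ (P.d + 2) * (P.eps⁻¹) ^ P.d = P.eps ^ 2 := by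
    rw [inv_pow, ← div_eq_mul_inv, div_eq_iff (pow_ne_zero _ hε.ne'), ← pow_add, add_comm]
  -- the scale factor of the piece bounds
  have hfac : ∀ (j p : ℕ) (x x' : Site P 0),
      C * (P.spacing j)⁻¹ ^ p * Real.exp (-(δ * (P.spacing j)⁻¹ * (P.eps * (Site.tdist x x' : ℝ)))) =
        C * (P.eps⁻¹) ^ p * ((((P.L : ℝ) ^ j)⁻¹) ^ p * Real.exp (-(δ * (Site.tdist x x' : ℕ) / (P.L : ℝ) ^ j))) := by
    intro j p x x'
    rw [spacing_inv_pow, rate_rewrite]; ring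
  -- the sum over the scales against the sup distance
  have hscale : ∀ {p : ℕ} {S : ℝ} (hS : 0 < S)
      (hSb : ∀ k n : ℕ, ∑ j ∈ range k, (((P.L : ℝ) ^ j)⁻¹) ^ p * Real.exp (-(δ * n / (P.L : ℝ) ^ j)) ≤ S / (max (n : ℝ) 1) ^ p)
      (x x' : Site P 0),
      ∑ j ∈ range k, (((P.L : ℝ) ^ j)⁻¹) ^ p * Real.exp (-(δ * (Site.tdist x x' : ℕ) / (P.L : ℝ) ^ j)) ≤
        S / (max (supDist x x' : ℝ) 1) ^ p := by
    intro p S hS hSb x x'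
    refine (hSb k (Site.tdist x x')).trans ?_
    refine div_le_div_of_nonneg_left hS.le (by positivity) ?_
    refine pow_le_pow_left₀ (by positivity) (max_le_max_right 1 ?_) p
    exact_mod_cast supDist_le_tdist x x'
  constructor
  · intro μ x x'
    rw [diff₁_eq_sum_pieces ha hmsq hkm, abs_mul, abs_of_pos (pow_pos hε _)]
    have hsum : |∑ j ∈ range k, d1Kernel P.eps⁻¹ μ (gpiece P a msq k j) x x'| ≤
        C * (P.eps⁻¹) ^ (P.d - 1) * (S₁ / (max (supDist x x' : ℝ) 1) ^ (P.d - 1)) := by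
      refine (abs_sum_le_sum_abs _ _).trans ?_
      calc ∑ j ∈ range k, |d1Kernel P.eps⁻¹ μ (gpiece P a msq k j) x x'|
          ≤ ∑ j ∈ range k, C * (P.eps⁻¹) ^ (P.d - 1) *
              ((((P.L : ℝ) ^ j)⁻¹) ^ (P.d - 1) * Real.exp (-(δ * (Site.tdist x x' : ℕ) / (P.L : ℝ) ^ j))) :=
            sum_le_sum fun j _ => by
              rw [← hfac j (P.d - 1) x x', ← rpow_one_sub_natCast (P.spacing_pos j) P.hd]
              exact hd1 j μ x x'
        _ = C * (P.eps⁻¹) ^ (P.d - 1) *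
              ∑ j ∈ range k, (((P.L : ℝ) ^ j)⁻¹) ^ (P.d - 1) * Real.exp (-(δ * (Site.tdist x x' : ℕ) / (P.L : ℝ) ^ j)) := by
            rw [Finset.mul_sum]
        _ ≤ _ := mul_le_mul_of_nonneg_left (hscale hS₁pos hS₁ x x') (by positivity)
    calc P.eps ^ (P.d + 1) * |∑ j ∈ range k, d1Kernel P.eps⁻¹ μ (gpiece P a msq k j) x x'|
        ≤ P.eps ^ (P.d + 1) * (C * (P.eps⁻¹) ^ (P.d - 1) * (S₁ / (max (supDist x x' : ℝ) 1) ^ (P.d - 1))) :=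
          mul_le_mul_of_nonneg_left hsum (by positivity)
      _ = C * S₁ * (P.eps ^ (P.d + 1) * (P.eps⁻¹) ^ (P.d - 1)) / (max (supDist x x' : ℝ) 1) ^ (P.d - 1) := by
          ring
      _ = C * S₁ * P.eps ^ 2 / (max (supDist x x' : ℝ) 1) ^ (P.d - 1) := by rw [hpow₁]
      _ ≤ C * max S₁ S₂ * P.eps ^ 2 / (max (supDist x x' : ℝ) 1) ^ (P.d - 1) := by
          refine div_le_div_of_nonneg_right ?_ (by positivity)
          exact mul_le_mul_of_nonneg_right (mul_le_mul_of_nonneg_left (le_max_left _ _) hC.le) (by positivity)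
  · intro μ ν x x'
    rw [diff₂_eq_sum_pieces ha hmsq hkm, abs_mul, abs_of_pos (pow_pos hε _)]
    have hsum : |∑ j ∈ range k, d2Kernel P.eps⁻¹ μ ν (gpiece P a msq k j) x x'| ≤
        C * (P.eps⁻¹) ^ P.d * (S₂ / (max (supDist x x' : ℝ) 1) ^ P.d) := by
      refine (abs_sum_le_sum_abs _ _).trans ?_
      calc ∑ j ∈ range k, |d2Kernel P.eps⁻¹ μ ν (gpiece P a msq k j) x x'|
          ≤ ∑ j ∈ range k, C * (P.eps⁻¹) ^ P.d *
              ((((P.L : ℝ) ^ j)⁻¹) ^ P.d * Real.exp (-(δ * (Site.tdist x x' : ℕ) / (P.L : ℝ) ^ j))) :=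
            sum_le_sum fun j _ => by
              rw [← hfac j P.d x x', ← rpow_neg_natCast' (P.spacing_pos j) P.d]
              exact hd2 j μ ν x x'
        _ = C * (P.eps⁻¹) ^ P.d *
              ∑ j ∈ range k, (((P.L : ℝ) ^ j)⁻¹) ^ P.d * Real.exp (-(δ * (Site.tdist x x' : ℕ) / (P.L : ℝ) ^ j)) := by
            rw [Finset.mul_sum]
        _ ≤ _ := mul_le_mul_of_nonneg_left (hscale hS₂pos hS₂ x x') (by positivity)
    calc P.eps ^ (P.d + 2) * |∑ j ∈ range k, d2Kernel P.eps⁻¹ μ ν (gpiece P a msq k j) x x'|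
        ≤ P.eps ^ (P.d + 2) * (C * (P.eps⁻¹) ^ P.d * (S₂ / (max (supDist x x' : ℝ) 1) ^ P.d)) :=
          mul_le_mul_of_nonneg_left hsum (by positivity)
      _ = C * S₂ * (P.eps ^ (P.d + 2) * (P.eps⁻¹) ^ P.d) / (max (supDist x x' : ℝ) 1) ^ P.d := by
          ring
      _ = C * S₂ * P.eps ^ 2 / (max (supDist x x' : ℝ) 1) ^ P.d := by rw [hpow₂]
      _ ≤ C * max S₁ S₂ * P.eps ^ 2 / (max (supDist x x' : ℝ) 1) ^ P.d := by
          refine div_le_div_of_nonneg_right ?_ (by positivity)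
          exact mul_le_mul_of_nonneg_right (mul_le_mul_of_nonneg_left (le_max_right _ _) hC.le) (by positivity)

end

end Literature.MathematicalPhysics.QuantumFieldTheory.BalabanImbrieJaffe1984to88.BIJ85FlatPropagatorKernelDiffs
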